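import Summits.AtomisticToContinuum.Crystallization.Theorems.PalmUnimodularRigidityLayeredLawsSelectHcpSelectionDefs
import Summits.AtomisticToContinuum.Crystallization.Theorems.PalmUnimodularRigidityLayeredLawsSelectHcpCertificateDefsB

/-!
# Strategist Sketch (cstrat s1) — first lemmas of crux idea `selection-word-local-certificates`
# (crux `LayeredLawsSelectHcp`, stmt-AtomisticToContinuum-9226; lens: transfer of the lead-c2 frame-free
# pointwise-certificate architecture from the hcp word to every local Barlow environment)

Typed over existing declarations only; `def … : Prop` (nothing to prove here).
-/

noncomputable section

namespace Summit.AtomisticToContinuum.Crystallization.Cruxes.LayeredLawsSelectHcp.StrategistOne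

open MeasureTheory Set
open Summit.AtomisticToContinuum.Crystallization.Theorems.LayeredLawsSelectHcp.Negative.DiracLaws
  (PointStationary meanRootEnergy Layered)
open Summit.AtomisticToContinuum.Crystallization.Theorems.PalmUnimodularRigidity.LayeredLawsSelectHcp
  (pts IsCubicSite cubicRoot)

/-- Euclidean `3`-space. [folklore] -/
local notation "E3" => EuclideanSpace ℝ (Fin 3)

/-- **First lemma (S3′ of the idea) — FAULT-ADJACENCY CHARGING by mass transport.**  Under a point-stationary layered
law the event "some cubic (faulted) site lies within distance `R` of the root" has probability at most `N_R · P(cubicRoot)`,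
`N_R = (4R/δ + 1)³` a hard-core bound on the number of atoms in `B_R` (`δ = 891/1000` for layered laws,
`Negative.RootedRedundant`): Mecke with `g(μ, y) = 1[y cubic in pts μ, ‖y‖ ≤ R]` gives
`E #{cubic y, ‖y‖ ≤ R} = E[#{y : ‖y‖ ≤ R}; root cubic] ≤ N_R · P(cubicRoot)`, and `P(∃) ≤ E #`.  This is what lets the
word-local pointwise certificates pay a Young loss `λ` at every site within `R` of a fault and charge it to the fault
density: total loss `≤ λ N_R ρ_c ≪ m ρ_c`. [folklore] -/
def FaultAdjacencyCharging : Prop :=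
  ∀ R : ℝ, 0 < R → ∀ P : Measure (Measure E3), IsProbabilityMeasure P → PointStationary P → Layered P →
    P {μ | ∃ y : E3, IsCubicSite (pts μ) y ∧ ‖y‖ ≤ R} ≤
      ENNReal.ofReal ((4 * R / (891 / 1000) + 1) ^ 3) * P cubicRoot

/-- **Second typed statement (S1 of the idea, the density-form Hägg step it shares with line
`stress-jump-young-hagg-density`) in its e*-free, chart-free LAW form — the FAULT PRICE for IDEAL references is not
typable chart-free without a reference-energy functional, so the line states the END inequality it must deliver
together with the certificates: `e(hcp a₀ h₀) + (m − λ N_R)·P(cubicRoot) ≤ E_P[h]` for every point-stationary layered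
law, `m − λ N_R > 0`.  With `c > 0` this is `SelectionInequality` of the sibling skeleton at the relaxed cell; the
child `SelectionFloor` of the prepared split follows by the sandwich. [folklore] -/
def FaultPriceInequality (a₀ h₀ : ℝ) (ha₀ : a₀ ≠ 0) (hh₀ : h₀ ≠ 0) : Prop :=
  ∃ c : ℝ, 0 < c ∧ ∀ P : Measure (Measure E3), IsProbabilityMeasure P → PointStationary P → Layered P →
    (Literature.MathematicalPhysics.StatisticalMechanics.hcpPeriodicConfiguration ha₀ hh₀).energyPerParticle
        Literature.MathematicalPhysics.StatisticalMechanics.lennardJones + c * (P cubicRoot).toReal ≤ meanRootEnergy P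

end Summit.AtomisticToContinuum.Crystallization.Cruxes.LayeredLawsSelectHcp.StrategistOne

end
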